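import Mathlib
import Summits.PneNP.PneNP.Theorems.CnfIdealGenLengthRankDefectRepresentationsMergeLowerBound
import Summits.PneNP.PneNP.Theorems.CnfIdealGenLengthRankDefectRepresentationsCutLemma

/-!
# Crux `RankDefectRepresentations` (stmt-PneNP-18923), line `rank-dehn-ladder`: the SIM / MP_n gluing problem and its halving
# reduction to a TWO-FAMILY CUT LEMMA (lead g8; `Lines/rank-dehn-ladder-g8.md` §6, §8)

SIM (= g5's multiplicity-free model problem MP_n = g7's (SIM)) is the depth-2 core of `stub_uniformStability`: rows coloured by
`row : ι → κ → Bool`, columns by `col`, `cut k M := M ∘ 1[row(x)_k ≠ col(y)_k]`; data `y_k` supported on the `k`-cut and pairwise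
consistent on overlaps up to rank `t` (`rank (cut k (cut l (y_k − y_l))) ≤ t`); wanted ONE matrix `z` with `rank (cut k (z − y_k)) ≤ C·t`
for all `k` (`SimBound κ C`).  Two-step almost-representations `E_k = [[P_k, X_k],[0, Q_k]]` are within rank `SIM-opt` of genuine ones of
the same shape (memo §6), every oblivious gluing is exponential in `|κ|` (memo §6), translation-invariant data are polynomial (memo §7).

This file kernel-checks the HALVING STEP of memo §8: a SIM bound for the coordinates `κ`, a SIM bound for `κ'`, and the
two-family cut lemma `TwoFamilyCutLemma κ κ' λ` (all mixed double cuts of `D` small ⟹ `D = S_I + S_J + L`, `S_I` supported on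
"all `κ`-colours agree", `S_J` on "all `κ'`-colours agree", `rank L ≤ λ s`) give a SIM bound for `κ ⊕ κ'` (`simBound_sum`), with the constant
`C₁ + C₂ + 2 λ (2C₁ + 2C₂ + 1)`; with the natural `λ = O(|κ||κ'|)` and a balanced splitting this iterates to `n^{O(log n)}` — SIM would
be QUASI-POLYNOMIAL given the two-family cut lemma, which generalises the landed cut lemma N1 (p642852); its `|κ'| = 1` case IS the cut
lemma (`twoFamilyCutLemma_one`, proved here from `stub_cutLemma`), and the general case is the recommended next statement item.
Also `simBound_unit`: one coordinate is glued exactly (`C = 0`), so `simBound_sum` + `twoFamilyCutLemma_one` re-derive the sequential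
(exponential) scheme inside the kernel; the quasi-polynomial one waits for the balanced two-family lemma.
HONEST FRAMING: a conditional reduction; P ≠ NP is not moved; F-N2 is a FRONTIER formal rung.
-/

set_option linter.dupNamespace false -- `Summit.PneNP.PneNP.…`: summit = sub-problem name (D-0017)

namespace Summit.PneNP.PneNP.Theorems.CnfIdealGenLengthRankDefectRepresentationsSimReduction

open Matrix
open Summit.PneNP.PneNP.Theorems.CnfIdealGenLengthRankDefectRepresentationsMergeLowerBound (rank_add_le' rank_sub_le' rank_neg')

variable {K : Type} [Field K]

section Cuts

variable {ι ι' κ : Type} (row : ι → κ → Bool) (col : ι' → κ → Bool)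

/-- The `k`-th coordinate cut of a matrix: keep the entries whose row colour and column colour differ at `k`. -/
def cut (k : κ) (M : Matrix ι ι' K) : Matrix ι ι' K :=
  Matrix.of fun x y => if row x k ≠ col y k then M x y else 0

/-- Cuts are linear. -/
theorem cut_sub (k : κ) (M N : Matrix ι ι' K) : cut row col k (M - N) = cut row col k M - cut row col k N := by
  ext x y; simp only [cut, Matrix.of_apply, Matrix.sub_apply]; split_ifs <;> simp

/-- Cuts commute. -/
theorem cut_comm (k l : κ) (M : Matrix ι ι' K) : cut row col k (cut row col l M) = cut row col l (cut row col k M) := by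
  ext x y; simp only [cut, Matrix.of_apply]; split_ifs <;> rfl

/-- A matrix vanishing wherever the `k`-th colours differ has zero `k`-cut. -/
theorem cut_eq_zero_of_vanish (k : κ) (S : Matrix ι ι' K) (hS : ∀ x y, row x k ≠ col y k → S x y = 0) :
    cut row col k S = 0 := by
  ext x y
  simp only [cut, Matrix.of_apply, Matrix.zero_apply]
  split_ifs with h
  · exact hS x y h
  · rfl

variable [Fintype ι] [Fintype ι'] [DecidableEq ι] [DecidableEq ι']

/-- A cut is a sum of two "rectangles" and therefore at most doubles the rank. -/
theorem rank_cut_le (k : κ) (M : Matrix ι ι' K) : (cut row col k M).rank ≤ 2 * M.rank := by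
  classical
  set P0 : Matrix ι ι K := Matrix.diagonal fun x => if row x k then 0 else 1 with hP0
  set P1 : Matrix ι ι K := Matrix.diagonal fun x => if row x k then 1 else 0 with hP1
  set Q0 : Matrix ι' ι' K := Matrix.diagonal fun y => if col y k then 0 else 1 with hQ0
  set Q1 : Matrix ι' ι' K := Matrix.diagonal fun y => if col y k then 1 else 0 with hQ1
  have hdec : cut row col k M = P0 * M * Q1 + P1 * M * Q0 := by
    ext x y
    simp only [cut, Matrix.of_apply, Matrix.add_apply, hP0, hP1, hQ0, hQ1, Matrix.diagonal_mul, Matrix.mul_diagonal]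
    cases hr : row x k <;> cases hc : col y k <;> simp
  rw [hdec, two_mul]
  refine (rank_add_le' _ _).trans (Nat.add_le_add ?_ ?_)
  · exact (Matrix.rank_mul_le_left _ _).trans (Matrix.rank_mul_le_right _ _)
  · exact (Matrix.rank_mul_le_left _ _).trans (Matrix.rank_mul_le_right _ _)

end Cuts

/-- **SIM bound with constant `C` for the coordinate type `κ`**: every family `y_k` supported on the `k`-cuts and pairwise consistent
on overlaps up to rank `t` is glued by ONE matrix `z` with `rank (cut k (z − y_k)) ≤ C·t` for every `k`. -/
def SimBound (K : Type) [Field K] (κ : Type) (C : ℕ) : Prop :=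
  ∀ (ι ι' : Type) [Fintype ι] [Fintype ι'] [DecidableEq ι] [DecidableEq ι']
    (row : ι → κ → Bool) (col : ι' → κ → Bool) (y : κ → Matrix ι ι' K) (t : ℕ),
    (∀ k, cut row col k (y k) = y k) →
    (∀ k l, (cut row col k (cut row col l (y k - y l))).rank ≤ t) →
    ∃ z : Matrix ι ι' K, ∀ k, (cut row col k (z - y k)).rank ≤ C * t

/-- **Two-family cut lemma with constant `λ`** (N1⁽²⁾ of the memo; OPEN beyond `|κ'| = 1`): if all mixed double cuts of `D` have rank
`≤ s`, then `D = S_I + S_J + L` with `S_I` supported on "all `κ`-colours agree", `S_J` supported on "all `κ'`-colours agree" and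
`rank L ≤ λ · s` (the natural conjecture is `λ = O(|κ| |κ'|)`; `|κ'| = 1` holds by the landed cut lemma, `twoFamilyCutLemma_one`). -/
def TwoFamilyCutLemma (K : Type) [Field K] (κ κ' : Type) (lam : ℕ) : Prop :=
  ∀ (ι ι' : Type) [Fintype ι] [Fintype ι'] [DecidableEq ι] [DecidableEq ι']
    (row : ι → κ ⊕ κ' → Bool) (col : ι' → κ ⊕ κ' → Bool) (D : Matrix ι ι' K) (s : ℕ),
    (∀ k k', (cut row col (Sum.inl k) (cut row col (Sum.inr k') D)).rank ≤ s) →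
    ∃ SI SJ : Matrix ι ι' K,
      (∀ x y, (∃ k, row x (Sum.inl k) ≠ col y (Sum.inl k)) → SI x y = 0) ∧
      (∀ x y, (∃ k', row x (Sum.inr k') ≠ col y (Sum.inr k')) → SJ x y = 0) ∧
      (D - SI - SJ).rank ≤ lam * s

/-- **HALVING STEP** (memo §8): SIM bounds for `κ` and `κ'` plus the two-family cut lemma give a SIM bound for `κ ⊕ κ'`.
Solve both halves, decompose the difference of the two half-solutions `D = z_I − z_J = S_I + S_J + L` (its mixed double cuts are
`cut_k cut_k' (z_I − y_k) + cut_k cut_k'(y_k − y_k') − cut_k cut_k' (z_J − y_k')`, rank `≤ (2C₁ + 2C₂ + 1) t`), and glue with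
`z := z_I − S_I = z_J + S_J + L`: the `κ`-errors are unchanged, the `κ'`-errors grow by `rank (cut L) ≤ 2 rank L`. -/
theorem simBound_sum {κ κ' : Type} {C₁ C₂ lam : ℕ}
    (h₁ : SimBound K κ C₁) (h₂ : SimBound K κ' C₂) (hTF : TwoFamilyCutLemma K κ κ' lam) :
    SimBound K (κ ⊕ κ') (C₁ + C₂ + 2 * lam * (2 * C₁ + 2 * C₂ + 1)) := by
  intro ι ι' _ _ _ _ row col y t hsupp hcons
  -- the two half instances
  obtain ⟨zI, hzI⟩ := h₁ ι ι' (fun x k => row x (Sum.inl k)) (fun x k => col x (Sum.inl k)) (fun k => y (Sum.inl k)) t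
    (fun k => hsupp (Sum.inl k)) (fun k l => hcons (Sum.inl k) (Sum.inl l))
  obtain ⟨zJ, hzJ⟩ := h₂ ι ι' (fun x k => row x (Sum.inr k)) (fun x k => col x (Sum.inr k)) (fun k => y (Sum.inr k)) t
    (fun k => hsupp (Sum.inr k)) (fun k l => hcons (Sum.inr k) (Sum.inr l))
  -- `cut` for the restricted colourings is `cut` for the sum colouring at `inl`/`inr` (definitionally)
  have cutI : ∀ k (M : Matrix ι ι' K),
      cut (fun x k => row x (Sum.inl k)) (fun x k => col x (Sum.inl k)) k M = cut row col (Sum.inl k) M := fun _ _ => rfl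
  have cutJ : ∀ k (M : Matrix ι ι' K),
      cut (fun x k => row x (Sum.inr k)) (fun x k => col x (Sum.inr k)) k M = cut row col (Sum.inr k) M := fun _ _ => rfl
  simp only [cutI] at hzI
  simp only [cutJ] at hzJ
  -- mixed double cuts of D := zI − zJ
  set D := zI - zJ with hD
  have hdouble : ∀ k k', (cut row col (Sum.inl k) (cut row col (Sum.inr k') D)).rank ≤ (2 * C₁ + 2 * C₂ + 1) * t := by
    intro k k'
    set A := cut row col (Sum.inl k) (cut row col (Sum.inr k') (zI - y (Sum.inl k))) with hA
    set B := cut row col (Sum.inl k) (cut row col (Sum.inr k') (y (Sum.inl k) - y (Sum.inr k'))) with hB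
    set C := cut row col (Sum.inl k) (cut row col (Sum.inr k') (zJ - y (Sum.inr k'))) with hC
    have e : cut row col (Sum.inl k) (cut row col (Sum.inr k') D) = A + B - C := by
      ext x y
      simp only [hA, hB, hC, hD, cut, Matrix.of_apply, Matrix.sub_apply, Matrix.add_apply]
      split_ifs <;> ring
    rw [e]
    have rA : A.rank ≤ 2 * (C₁ * t) := by
      rw [hA, cut_comm]
      exact (rank_cut_le row col _ _).trans (Nat.mul_le_mul_left 2 (hzI k))
    have rB : B.rank ≤ t := hcons _ _
    have rC : C.rank ≤ 2 * (C₂ * t) := (rank_cut_le row col _ _).trans (Nat.mul_le_mul_left 2 (hzJ k'))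
    calc (A + B - C).rank ≤ (A + B).rank + C.rank := rank_sub_le' _ _
      _ ≤ (A.rank + B.rank) + C.rank := Nat.add_le_add_right (rank_add_le' _ _) _
      _ ≤ (2 * (C₁ * t) + t) + 2 * (C₂ * t) := Nat.add_le_add (Nat.add_le_add rA rB) rC
      _ = (2 * C₁ + 2 * C₂ + 1) * t := by ring
  obtain ⟨SI, SJ, hSI, hSJ, hL⟩ := hTF ι ι' row col D ((2 * C₁ + 2 * C₂ + 1) * t) hdouble
  refine ⟨zI - SI, ?_⟩
  rintro (k | k')
  · -- `κ`-errors are unchanged: `cut (inl k) SI = 0`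
    have e : zI - SI - y (Sum.inl k) = (zI - y (Sum.inl k)) - SI := by abel
    rw [e, cut_sub, cut_eq_zero_of_vanish row col (Sum.inl k) SI (fun x y h => hSI x y ⟨k, h⟩), sub_zero]
    refine (hzI k).trans (Nat.mul_le_mul_right _ ?_)
    omega
  · -- `κ'`-errors: `zI − SI = zJ + SJ + L`, `cut (inr k') SJ = 0`, `rank (cut L) ≤ 2 rank L`
    have e : zI - SI - y (Sum.inr k') = (zJ - y (Sum.inr k')) + SJ + (D - SI - SJ) := by rw [hD]; abel
    rw [e, show (zJ - y (Sum.inr k')) + SJ + (D - SI - SJ) = ((zJ - y (Sum.inr k')) + (D - SI - SJ)) - (-SJ) by abel,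
      cut_sub, show cut row col (Sum.inr k') (-SJ) = 0 from ?_, sub_zero]
    · have e2 : cut row col (Sum.inr k') ((zJ - y (Sum.inr k')) + (D - SI - SJ))
          = cut row col (Sum.inr k') (zJ - y (Sum.inr k')) - cut row col (Sum.inr k') (-(D - SI - SJ)) := by
        rw [← cut_sub]; congr 1; abel
      rw [e2]
      calc _ ≤ (cut row col (Sum.inr k') (zJ - y (Sum.inr k'))).rank + (cut row col (Sum.inr k') (-(D - SI - SJ))).rank :=
            rank_sub_le' _ _
        _ ≤ C₂ * t + 2 * (lam * ((2 * C₁ + 2 * C₂ + 1) * t)) := by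
            refine Nat.add_le_add (hzJ k') ?_
            refine (rank_cut_le row col _ _).trans (Nat.mul_le_mul_left 2 ?_)
            rw [rank_neg']; exact hL
        _ ≤ _ := by nlinarith
    · apply cut_eq_zero_of_vanish
      intro x y h
      simp only [Matrix.neg_apply, neg_eq_zero]
      exact hSJ x y ⟨k', h⟩


/-- One coordinate is glued exactly: `SimBound K (Fin 1) 0` (take `z := y 0`). -/
theorem simBound_unit : SimBound K (Fin 1) 0 := by
  intro ι ι' _ _ _ _ row col y t hsupp hcons
  refine ⟨y 0, fun k => ?_⟩
  have hk : k = 0 := Subsingleton.elim _ _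
  subst hk
  have h0 : cut row col 0 (y 0 - y 0) = 0 := by
    rw [sub_self]; ext x y'; simp [cut]
  rw [h0, Matrix.rank_zero]
  exact Nat.zero_le _

/-- **The two-family cut lemma for a single second coordinate IS the cut lemma N1** (p642852): `D = D∘[agree at j] + cut_j D`, and the
landed `stub_cutLemma` applied to `cut_j D` with the `κ = Fin n` colouring (its coordinate cuts are exactly the mixed double cuts) writes
`cut_j D = S_I + L`. -/
theorem twoFamilyCutLemma_one (n : ℕ) : ∃ lam, TwoFamilyCutLemma K (Fin n) (Fin 1) lam := by
  classical
  obtain ⟨C, a, hCL⟩ :=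
    Summit.PneNP.PneNP.Theorems.CnfIdealGenLengthRankDefectRepresentationsCutLemma.stub_cutLemma
  refine ⟨C * (n + 1) ^ a, ?_⟩
  intro ι ι' _ _ _ _ row col D s hs
  -- the matrix `R := cut_{inr 0} D` with the `Fin n` colouring `x ↦ (k ↦ row x (inl k))`
  set R := cut row col (Sum.inr 0) D with hR
  have hcut : ∀ j : Fin n, (Matrix.of fun x y =>
      if (fun x k => row x (Sum.inl k)) x j ≠ (fun y k => col y (Sum.inl k)) y j then R x y else 0).rank ≤ s := by
    intro j
    have : (Matrix.of fun x y =>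
        if (fun x k => row x (Sum.inl k)) x j ≠ (fun y k => col y (Sum.inl k)) y j then R x y else 0)
        = cut row col (Sum.inl j) (cut row col (Sum.inr 0) D) := by
      rw [hR]; rfl
    rw [this]; exact hs j 0
  obtain ⟨R', hR'supp, hR'rank⟩ := hCL K n ι ι' (fun x k => row x (Sum.inl k)) (fun y k => col y (Sum.inl k)) s R hcut
  refine ⟨R', D - R, ?_, ?_, ?_⟩
  · intro x y ⟨k, hk⟩
    apply hR'supp
    intro h
    exact hk (by simpa using congrFun h k)
  · intro x y ⟨k', hk'⟩
    have hk0 : k' = 0 := Subsingleton.elim _ _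
    subst hk0
    simp only [hR, Matrix.sub_apply, cut, Matrix.of_apply, if_pos hk', sub_self]
  · have e : D - R' - (D - R) = R - R' := by abel
    rw [e]
    exact hR'rank

end Summit.PneNP.PneNP.Theorems.CnfIdealGenLengthRankDefectRepresentationsSimReduction
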